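import Literature.Analysis.FunctionSpaces.PVSeq
import HarnessLib

/-!
# A toolkit of `PV`-definable functions, V: yardsticks for polynomial length bounds

Topic `Literature/Analysis/FunctionSpaces`, continuing `PVSeq.lean`.  The closure lemmas of Cobham's
class for loops, sums and powers (`IsPVDefinable.of_loopNat`, `of_sumBelow`, `two_pow_of_le`, …) ask
for a definable *yardstick* `S` with the relevant quantity bounded by the length `|S x|`.  This file
provides the yardsticks once and for all: smash towers `ypow Y d` with `|ypow Y d| ≥ |Y|^d`, so that a
bound of the shape `G x ≤ |Y x|^d` suffices (`two_pow_of_le_ypow`, `loopNat_ypow`, `sumBelow_ypow`, …),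
and the standard yardstick `yd N = (N + 1)·2^64` of a datum `N` (`|N| ≤ |yd N|`, `65 ≤ |yd N|`; the
constant `64` lets polynomial bounds with moderate coefficients be absorbed into one more power).

## References

* S. R. Buss, *Bounded Arithmetic*, Bibliopolis 1986, §2.2 (the smash function and polynomial length bounds).
* A. Cobham, *The intrinsic computational difficulty of functions*, 1965.
-/

namespace Literature.Analysis.FunctionSpaces

open PVFun

variable {n : ℕ}

/-! ## Smash towers -/

/-- `ypow Y 0 = Y`, `ypow Y (d+1) = Y # ypow Y d = 2^{|Y|·|ypow Y d|}`. [cite: Buss1986, §2.2] -/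
def ypow (Y : ℕ) : ℕ → ℕ
  | 0 => Y
  | d + 1 => 2 ^ (Y.size * (ypow Y d).size)

/-- `|Y|^d ≤ |ypow Y d|` for `d ≥ 1` (as a disjunction covering `d = 0`). [cite: Buss1986, §2.2] -/
theorem pow_size_le_size_ypow (Y : ℕ) : ∀ d : ℕ, Y.size ^ d ≤ (ypow Y d).size ∨ (d = 0)
  | 0 => Or.inr rfl
  | d + 1 => by
    left
    rw [ypow, Nat.size_pow, pow_succ, mul_comm]
    rcases pow_size_le_size_ypow Y d with h | h
    · exact (Nat.mul_le_mul_left _ h).trans (Nat.le_succ _)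
    · subst h
      show Y.size * 1 ≤ Y.size * (ypow Y 0).size + 1
      rw [ypow, mul_one]
      rcases Nat.eq_zero_or_pos Y.size with h0 | h0
      · simp [h0]
      · exact (Nat.le_mul_of_pos_right _ h0).trans (Nat.le_succ _)

/-- **`|Y|^d ≤ |ypow Y d|`** for `d ≥ 1`, and `|Y| ≤ |ypow Y d|` always. [cite: Buss1986, §2.2] -/
theorem pow_size_le (Y : ℕ) {d : ℕ} (hd : 1 ≤ d) : Y.size ^ d ≤ (ypow Y d).size := by
  rcases pow_size_le_size_ypow Y d with h | h
  · exact h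
  · omega

/-- `|Y| ≤ |ypow Y d|`. [cite: Buss1986, §2.2] -/
theorem size_le_size_ypow (Y d : ℕ) : Y.size ≤ (ypow Y d).size := by
  rcases d with _ | d
  · exact le_rfl
  · calc Y.size = Y.size ^ 1 := (pow_one _).symm
      _ ≤ Y.size ^ (d + 1) := by
          rcases Nat.eq_zero_or_pos Y.size with h | h
          · simp [h]
          · exact Nat.pow_le_pow_right h (by omega)
      _ ≤ (ypow Y (d + 1)).size := pow_size_le Y (by omega)

/-- Smash towers of definable functions are definable. [cite: Buss1986, §2.2] -/
theorem IsPVDefinable.ypow {Y : (Fin n → ℕ) → ℕ} (hY : IsPVDefinable Y) : ∀ d : ℕ, IsPVDefinable fun x => FunctionSpaces.ypow (Y x) d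
  | 0 => hY
  | d + 1 => (hY.smash (hY.ypow d)).of_eq fun x => by rw [FunctionSpaces.ypow]

/-! ## Closure lemmas with polynomial length bounds -/

section Poly

variable {G Y K B Bw Bd M : (Fin n → ℕ) → ℕ} {St : (Fin n → ℕ) → ℕ → ℕ → ℕ} {h g P : (Fin n → ℕ) → ℕ → ℕ}

/-- `2^G` for `G ≤ |Y|^d`. [cite: Buss1986, §2.2] -/
theorem IsPVDefinable.two_pow_of_le_ypow (hG : IsPVDefinable G) (hY : IsPVDefinable Y) (d : ℕ) (hle : ∀ x, G x ≤ (Y x).size ^ d) :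
    IsPVDefinable fun x => 2 ^ G x := by
  rcases d with _ | d
  · exact hG.two_pow_of_le (IsPVDefinable.const 1) fun x => by simpa using hle x
  · exact hG.two_pow_of_le (hY.ypow (d + 1)) fun x => (hle x).trans (pow_size_le _ (by omega))

/-- `F^G` for `G ≤ |Y|^d`. [cite: Buss1986, §2.2] -/
theorem IsPVDefinable.pow_of_le_ypow {F : (Fin n → ℕ) → ℕ} (hF : IsPVDefinable F) (hG : IsPVDefinable G) (hY : IsPVDefinable Y) (d : ℕ)
    (hle : ∀ x, G x ≤ (Y x).size ^ d) : IsPVDefinable fun x => F x ^ G x := by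
  rcases d with _ | d
  · exact hF.pow_of_le hG (IsPVDefinable.const 1) fun x => by simpa using hle x
  · exact hF.pow_of_le hG (hY.ypow (d + 1)) fun x => (hle x).trans (pow_size_le _ (by omega))

/-- Loops of `K ≤ |Y|^d` rounds. [cite: Cobham1965] -/
theorem IsPVDefinable.loopNat_ypow (hB : IsPVDefinable B)
    (hSt : IsPVDefinable fun v : Fin (n + 2) → ℕ => St (Fin.init (Fin.init v)) (v (Fin.last n).castSucc) (v (Fin.last (n + 1))))
    (hK : IsPVDefinable K) (hY : IsPVDefinable Y) (d : ℕ) (hKY : ∀ x, K x ≤ (Y x).size ^ d) (hBd : IsPVDefinable Bd)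
    (hle : ∀ x, ∀ i ≤ K x, loopNat (B x) (St x) i ≤ Bd x) : IsPVDefinable fun x => loopNat (B x) (St x) (K x) := by
  rcases d with _ | d
  · exact IsPVDefinable.of_loopNat hB hSt hK (IsPVDefinable.const 1) (fun x => by simpa using hKY x) hBd hle
  · exact IsPVDefinable.of_loopNat hB hSt hK (hY.ypow (d + 1)) (fun x => (hKY x).trans (pow_size_le _ (by omega))) hBd hle

/-- Sums of `K ≤ |Y|^d` terms. [cite: Buss1986, Ch. 1] -/
theorem IsPVDefinable.sumBelow_ypow (hh : IsPVDefinable fun v : Fin (n + 1) → ℕ => h (Fin.init v) (v (Fin.last n)))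
    (hK : IsPVDefinable K) (hY : IsPVDefinable Y) (d : ℕ) (hKY : ∀ x, K x ≤ (Y x).size ^ d) (hM : IsPVDefinable M)
    (hle : ∀ x, ∀ i < K x, h x i ≤ M x) : IsPVDefinable fun x => sumBelow (h x) (K x) := by
  rcases d with _ | d
  · exact IsPVDefinable.of_sumBelow hh hK (IsPVDefinable.const 1) (fun x => by simpa using hKY x) hM hle
  · exact IsPVDefinable.of_sumBelow hh hK (hY.ypow (d + 1)) (fun x => (hKY x).trans (pow_size_le _ (by omega))) hM hle

/-- Counts below `K ≤ |Y|^d`. [cite: Buss1986, Ch. 1] -/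
theorem IsPVDefinable.countBelow_ypow (hP : IsPVDefinable fun v : Fin (n + 1) → ℕ => P (Fin.init v) (v (Fin.last n)))
    (hK : IsPVDefinable K) (hY : IsPVDefinable Y) (d : ℕ) (hKY : ∀ x, K x ≤ (Y x).size ^ d) :
    IsPVDefinable fun x => countBelow (P x) (K x) := by
  rcases d with _ | d
  · exact IsPVDefinable.of_countBelow hP hK (IsPVDefinable.const 1) fun x => by simpa using hKY x
  · exact IsPVDefinable.of_countBelow hP hK (hY.ypow (d + 1)) fun x => (hKY x).trans (pow_size_le _ (by omega))

/-- Searches below `K ≤ |Y|^d`. [cite: Buss1986, Ch. 1] -/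
theorem IsPVDefinable.muNat_ypow (hP : IsPVDefinable fun v : Fin (n + 1) → ℕ => P (Fin.init v) (v (Fin.last n)))
    (hK : IsPVDefinable K) (hY : IsPVDefinable Y) (d : ℕ) (hKY : ∀ x, K x ≤ (Y x).size ^ d) :
    IsPVDefinable fun x => muNat (P x) (K x) := by
  rcases d with _ | d
  · exact IsPVDefinable.of_muNat hP hK (IsPVDefinable.const 1) fun x => by simpa using hKY x
  · exact IsPVDefinable.of_muNat hP hK (hY.ypow (d + 1)) fun x => (hKY x).trans (pow_size_le _ (by omega))

/-- Tabulations of `K ≤ |Y|^d` entries of width `Bw ≤ |Y|^d`. [cite: Buss1986, §2.5] -/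
theorem IsPVDefinable.seqOf_ypow (hg : IsPVDefinable fun v : Fin (n + 1) → ℕ => g (Fin.init v) (v (Fin.last n)))
    (hB : IsPVDefinable Bw) (hK : IsPVDefinable K) (hY : IsPVDefinable Y) (d : ℕ)
    (hKY : ∀ x, K x ≤ (Y x).size ^ d) (hBY : ∀ x, Bw x ≤ (Y x).size ^ d) : IsPVDefinable fun x => seqOf (Bw x) (g x) (K x) := by
  rcases d with _ | d
  · exact IsPVDefinable.of_seqOf hg hB hK (IsPVDefinable.const 1) (IsPVDefinable.const 1) (fun x => by simpa using hKY x) fun x => by simpa using hBY x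
  · exact IsPVDefinable.of_seqOf hg hB hK (hY.ypow (d + 1)) (hY.ypow (d + 1)) (fun x => (hKY x).trans (pow_size_le _ (by omega)))
      fun x => (hBY x).trans (pow_size_le _ (by omega))

end Poly

/-! ## The standard yardstick of a datum -/

/-- `yd N = (N + 1) · 2^64`. [folklore] -/
def yd (N : ℕ) : ℕ := (N + 1) * 2 ^ 64

/-- `yd` is in Cobham's class. [cite: Cobham1965] -/
theorem pv_yd : PV₁ yd := ((IsPVDefinable.proj 0).succ).mul (IsPVDefinable.const _)

/-- `|yd N| = |N + 1| + 64`. [folklore] -/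
theorem size_yd (N : ℕ) : (yd N).size = (N + 1).size + 64 := by
  unfold yd; rw [← Nat.shiftLeft_eq, Nat.size_shiftLeft (Nat.succ_ne_zero N)]

/-- `|N| ≤ |yd N|`. [folklore] -/
theorem size_le_size_yd (N : ℕ) : N.size ≤ (yd N).size := by
  rw [size_yd]; have : N.size ≤ (N + 1).size := Nat.size_le_size (Nat.le_succ N); omega

/-- `65 ≤ |yd N|`. [folklore] -/
theorem size_yd_ge (N : ℕ) : 65 ≤ (yd N).size := by
  rw [size_yd]; have : 1 ≤ (N + 1).size := Nat.size_pos.2 (Nat.succ_pos N); omega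

/-- `|N| + 1 ≤ |yd N|`. [folklore] -/
theorem size_succ_le_size_yd (N : ℕ) : N.size + 1 ≤ (yd N).size := by
  rw [size_yd]; have : N.size ≤ (N + 1).size := Nat.size_le_size (Nat.le_succ N); omega

/-- Absorbing coefficients: `c · |yd N|^d ≤ |yd N|^(d+1)` for `c ≤ 65`. [folklore] -/
theorem mul_pow_size_yd_le {c : ℕ} (hc : c ≤ 65) (N d : ℕ) : c * (yd N).size ^ d ≤ (yd N).size ^ (d + 1) := by
  rw [pow_succ, mul_comm]; exact Nat.mul_le_mul_left _ (hc.trans (size_yd_ge N))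

end Literature.Analysis.FunctionSpaces
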